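import Summits.AtomisticToContinuum.HydrodynamicLimit.Theorems.OneFlightGossipEngineEnergyCurrentTailsLevelCensusForwardWindow
import Summits.AtomisticToContinuum.HydrodynamicLimit.Theorems.OneFlightGossipEngineEnergyCurrentTailsFirstPartnerObjects
import Literature.MathematicalPhysics.KineticTheory.CollisionFluxMeanBoundNonStationary
import Literature.Analysis.FluidPDE.HardSphereDynamicsProofs
import HarnessLib

/-!
# Crux `EnergyCurrentTails` (stmt-AtomisticToContinuum-9235), line `quartic-schur-ledger`:
# S2 of the rung-0 certificate of I′ — the PRE-collisional one-window flux engine for configuration marks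

Helper file (`--supports stmt-AtomisticToContinuum-9235`) of the registered stub `shareRung0_forwardEngine`.
The Cercignani–Illner–Pulvirenti one-window collision-flux bookkeeping (App. 4.A), in the FORWARD direction and
for an ARBITRARY mark of the PRE-collisional configuration `collidePair i j (Φ_r z)` at each ordered contact pair
of each collision time `r ∈ (s, s + τ]`, with an exported MEASURABLE majorant:

* `sum_collision_conf_le_sum_window_fwd` — PATHWISE (any geometry with continuous translations and Hausdorff
  positions): once the mesh `h = τ/M` is finer than the gap of the collision times in `[0, τ]`, the collision at
  `s′ ∈ (kh, (k+1)h]` is preceded by free flight on `[kh, s′)` (`IsHardSphereTrajectory.leftLim_eq_freeFlight`),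
  the left limit IS the pre-collisional configuration (`leftLim_eq_collidePair`) and has the positions of the
  value (`leftLim_apply_fst`), so `F (collidePair i j (γ s′)) i j = F (freeFlight (s′ − kh) (γ(kh))) i j ≤ Ft (γ(kh)) i j`
  and `γ(kh)` lies in the forward window event; distinct collision times go to distinct grid times
  (the configuration-mark twin of `EnergyCurrentTailsLevelCensus.sum_collision_pre_le_sum_window`);
* `finsum_collisionTimes_shift_Ioc` — the half-open twin of `finsum_collisionTimes_shift`;
* `shareRung0_forwardEngine` (registered) — the measurable grid majorant `g = liminf_M Σ_{k<M} W_M ∘ Φ_{kτ/M+s}`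
  on `𝕋³` and its mean under ANY law `P`: `∫ g dP ≤ liminf_M Σ_{k<M} ∫ W_M d((Φ_{kτ/M+s})_* P)` (Fatou,
  `lintegral_map`; the forward twin of `exists_measurable_majorant_collisionSum`).

References: C. Cercignani, R. Illner, M. Pulvirenti, *The Mathematical Theory of Dilute Gases* (1994), §4.3,
App. 4.A; I. Gallagher, L. Saint-Raymond, B. Texier, *From Newton to Boltzmann* (2013), Prop. 4.1.1.
-/

noncomputable section

open scoped BigOperators Classical ENNReal InnerProductSpace
open MeasureTheory Set Filter
open Literature.Analysis.FluidPDE Literature.MathematicalPhysics.KineticTheory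
  Literature.MathematicalPhysics.StatisticalMechanics

namespace Summit.AtomisticToContinuum.HydrodynamicLimit.Theorems

namespace QuarticSchurLedger

open EnergyCurrentTailsFirstPartner RateFloorLine

/-! ### Pathwise: a collision is preceded by free flight from the previous grid time -/

/-- **Pathwise forward window bound for marks of the PRE-collisional configuration.**  Let `γ` be a
hard-sphere trajectory in a geometry with continuous translations and Hausdorff positions, `τ > 0`,
`M ≥ 1`, and suppose the mesh `h = τ/M` is smaller than the gap between any two collision times in
`[0, τ]`.  Let `E i j` be events containing every non-overlapping configuration `w` whose pair `(i, j)`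
comes to contact after a FORWARD free flight of some duration `t ∈ [0, h]`, and let the mark `F` be
majorised there by `Ft` read at the START of the flight: `F (S_t w) i j ≤ Ft w i j`.  Then the collision
sum over `(0, τ]` of `F (collidePair i j (γ s)) i j` over the ordered contact pairs (the pre-collisional
configuration, i.e. the left limit) is at most the grid sum `Σ_{k<M} Σ_{i≠j} 𝟙_{E i j}(γ(kh)) Ft (γ(kh)) i j`.
[folklore] -/
theorem sum_collision_conf_le_sum_window_fwd {d X : Type*} [Fintype d] [TopologicalSpace X]
    [T2Space X] {G : Geometry d X} {ε : ℝ} {n : ℕ} {γ : ℝ → Config n d X}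
    (hγ : IsHardSphereTrajectory G ε n γ) (hG : ∀ x : X, Continuous (G.translate x)) {τ : ℝ}
    (hτ : 0 < τ) {M : ℕ} (hM : 0 < M)
    (hgap : ∀ s ∈ collisionTimes G ε γ ∩ Icc 0 τ, ∀ s' ∈ collisionTimes G ε γ ∩ Icc 0 τ,
      s < s' → τ / M < s' - s)
    (hfin : (collisionTimes G ε γ ∩ Ioc 0 τ).Finite)
    (E : Fin n → Fin n → Set (Config n d X))
    (hE : ∀ i j, i ≠ j → ∀ w ∈ hardSphereDomain G n ε, ∀ t ∈ Icc 0 (τ / M),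
      ‖G.sepVec ((freeFlight G t w i).1) ((freeFlight G t w j).1)‖ = ε → w ∈ E i j)
    (F Ft : Config n d X → Fin n → Fin n → ℝ≥0∞)
    (hFt : ∀ i j, i ≠ j → ∀ w ∈ hardSphereDomain G n ε, ∀ t ∈ Icc 0 (τ / M),
      ‖G.sepVec ((freeFlight G t w i).1) ((freeFlight G t w j).1)‖ = ε →
        F (freeFlight G t w) i j ≤ Ft w i j) :
    ∑ s ∈ hfin.toFinset, ∑ i, ∑ j,
        (if i ≠ j ∧ ‖G.sepVec (γ s i).1 (γ s j).1‖ = ε then F (collidePair G i j (γ s)) i j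
          else 0) ≤
      ∑ k ∈ Finset.range M, ∑ i, ∑ j,
        (if i ≠ j then (E i j).indicator (fun w => Ft w i j) (γ ((k : ℝ) * (τ / M))) else 0) := by
  classical
  -- adapted from `EnergyCurrentTailsLevelCensus.sum_collision_pre_le_sum_window`
  -- (`…LevelCensusForwardWindow`): velocity marks ↦ marks of the pre-collisional configuration
  set h : ℝ := τ / M with hhdef
  have hM' : (0 : ℝ) < M := by exact_mod_cast hM
  have hh : 0 < h := div_pos hτ hM'
  have hMh : (M : ℝ) * h = τ := by rw [hhdef]; field_simp
  set S : Set ℝ := collisionTimes G ε γ ∩ Ioc 0 τ with hSdef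
  have hTS : ∀ s, s ∈ hfin.toFinset ↔ s ∈ S := fun s => hfin.mem_toFinset
  have hSI : ∀ s ∈ S, s ∈ collisionTimes G ε γ ∩ Icc 0 τ := fun s hs =>
    ⟨hs.1, Ioc_subset_Icc_self hs.2⟩
  -- the grid index of a collision time: `κ s * h < s ≤ (κ s + 1) * h`
  set κ : ℝ → ℕ := fun s => ⌈s / h⌉₊ - 1 with hκ
  have hceil1 : ∀ s ∈ S, 1 ≤ ⌈s / h⌉₊ := fun s hs =>
    Nat.one_le_iff_ne_zero.2 (Nat.pos_iff_ne_zero.1 (Nat.ceil_pos.2 (div_pos hs.2.1 hh)))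
  have hκcast : ∀ s ∈ S, (κ s : ℝ) = (⌈s / h⌉₊ : ℝ) - 1 := fun s hs => by
    rw [hκ, Nat.cast_sub (hceil1 s hs), Nat.cast_one]
  have hκM : ∀ s ∈ S, κ s < M := by
    intro s hs
    have h1 : ⌈s / h⌉₊ ≤ M := Nat.ceil_le.2 (by rw [div_le_iff₀ hh, hMh]; exact hs.2.2)
    have h2 := hceil1 s hs
    show ⌈s / h⌉₊ - 1 < M
    omega
  have hκlt : ∀ s ∈ S, (κ s : ℝ) * h < s := by
    intro s hs
    have hs0 : 0 ≤ s / h := (div_pos hs.2.1 hh).le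
    have h1 : (⌈s / h⌉₊ : ℝ) < s / h + 1 := Nat.ceil_lt_add_one hs0
    have h2 : (κ s : ℝ) < s / h := by rw [hκcast s hs]; linarith
    have h3 := mul_lt_mul_of_pos_right h2 hh
    rwa [div_mul_cancel₀ _ hh.ne'] at h3
  have hκle : ∀ s ∈ S, s ≤ ((κ s : ℝ) + 1) * h := by
    intro s hs
    have h1 : s / h ≤ (⌈s / h⌉₊ : ℝ) := Nat.le_ceil _
    have h2 : (κ s : ℝ) + 1 = (⌈s / h⌉₊ : ℝ) := by rw [hκcast s hs]; ring
    rw [h2]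
    rw [div_le_iff₀ hh] at h1
    exact h1
  have hκ0 : ∀ s ∈ S, 0 ≤ (κ s : ℝ) * h := fun s _ => mul_nonneg (Nat.cast_nonneg _) hh.le
  -- no collision strictly between the grid time and `s`
  have hfreeI : ∀ s ∈ S, ∀ s' ∈ Ioo ((κ s : ℝ) * h) s, s' ∉ collisionTimes G ε γ := by
    intro s hs s' hs' hcoll
    have hs'S : s' ∈ collisionTimes G ε γ ∩ Icc 0 τ :=
      ⟨hcoll, (hκ0 s hs).trans hs'.1.le, hs'.2.le.trans hs.2.2⟩
    have h1 := hgap s' hs'S s (hSI s hs) hs'.2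
    have h2 := hκle s hs
    have h3 : ((κ s : ℝ) + 1) * h = (κ s : ℝ) * h + h := by ring
    linarith [hs'.1]
  have hleft : ∀ s ∈ S, Function.leftLim γ s = freeFlight G (s - (κ s : ℝ) * h) (γ ((κ s : ℝ) * h)) :=
    fun s hs => hγ.leftLim_eq_freeFlight hG (hκlt s hs) (hfreeI s hs)
  -- distinct collision times have distinct grid times
  have hinj : Set.InjOn κ (hfin.toFinset : Set ℝ) := by
    have key : ∀ s ∈ S, ∀ s' ∈ S, s < s' → κ s ≠ κ s' := by
      intro s hs s' hs' hlt heq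
      have h1 := hgap s (hSI s hs) s' (hSI s' hs') hlt
      have h2 := hκle s' hs'
      have h3 := hκlt s hs
      rw [heq] at h3
      have h4 : ((κ s' : ℝ) + 1) * h = (κ s' : ℝ) * h + h := by ring
      linarith
    intro s hs s' hs' heq
    rw [Finset.mem_coe, hTS] at hs hs'
    rcases lt_trichotomy s s' with hlt | heq' | hgt
    · exact absurd heq (key s hs s' hs' hlt)
    · exact heq'
    · exact absurd heq.symm (key s' hs' s hs hgt)
  -- the one-window functional
  set W : Config n d X → ℝ≥0∞ := fun w => ∑ i, ∑ j,
    (if i ≠ j then (E i j).indicator (fun w => Ft w i j) w else 0) with hW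
  -- termwise comparison at a collision time
  have hterm : ∀ s ∈ S, (∑ i, ∑ j,
      (if i ≠ j ∧ ‖G.sepVec (γ s i).1 (γ s j).1‖ = ε then F (collidePair G i j (γ s)) i j
        else 0)) ≤ W (γ ((κ s : ℝ) * h)) := by
    intro s hs
    rw [hW]
    refine Finset.sum_le_sum fun i _ => Finset.sum_le_sum fun j _ => ?_
    by_cases hc : i ≠ j ∧ ‖G.sepVec (γ s i).1 (γ s j).1‖ = ε
    · rw [if_pos hc, if_pos hc.1]
      set t : ℝ := s - (κ s : ℝ) * h with htdef
      have ht : t ∈ Icc 0 h := by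
        refine ⟨by rw [htdef]; linarith [hκlt s hs], ?_⟩
        have h2 := hκle s hs
        have h4 : ((κ s : ℝ) + 1) * h = (κ s : ℝ) * h + h := by ring
        rw [htdef]; linarith
      set w : Config n d X := γ ((κ s : ℝ) * h) with hwdef
      have hfl : freeFlight G t w = Function.leftLim γ s := (hleft s hs).symm
      -- the pre-collisional configuration is the free-flight value of the grid configuration
      have hcs : γ s ∈ contactSet G n ε i j := ⟨hγ.mem s, hc.2⟩
      have hpre : collidePair G i j (γ s) = freeFlight G t w := by
        rw [hfl, hγ.leftLim_eq_collidePair hc.1 hcs]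
      -- the grid configuration reaches contact after the forward flight `t`
      have hcontact : ‖G.sepVec ((freeFlight G t w i).1) ((freeFlight G t w j).1)‖ = ε := by
        rw [hfl, hγ.leftLim_apply_fst hG s i, hγ.leftLim_apply_fst hG s j]
        exact hc.2
      have hmem : w ∈ E i j := hE i j hc.1 w (hγ.mem _) t ht hcontact
      rw [indicator_of_mem hmem, hpre]
      exact hFt i j hc.1 w (hγ.mem _) t ht hcontact
    · rw [if_neg hc]
      exact bot_le
  -- sum over collision times ≤ sum over grid times
  calc ∑ s ∈ hfin.toFinset, ∑ i, ∑ j,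
        (if i ≠ j ∧ ‖G.sepVec (γ s i).1 (γ s j).1‖ = ε then F (collidePair G i j (γ s)) i j
          else 0)
      ≤ ∑ s ∈ hfin.toFinset, W (γ ((κ s : ℝ) * h)) :=
        Finset.sum_le_sum fun s hs => hterm s ((hTS s).1 hs)
    _ = ∑ k ∈ hfin.toFinset.image κ, W (γ ((k : ℝ) * h)) :=
        (Finset.sum_image (f := fun k : ℕ => W (γ ((k : ℝ) * h))) hinj).symm
    _ ≤ ∑ k ∈ Finset.range M, W (γ ((k : ℝ) * h)) := by
        refine Finset.sum_le_sum_of_subset fun k hk => ?_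
        rw [Finset.mem_image] at hk
        obtain ⟨s, hs, rfl⟩ := hk
        exact Finset.mem_range.2 (hκM s ((hTS s).1 hs))

/-! ### Shifting the half-open window -/

/-- **Shifting a collision sum to the window `(0, τ]`**: for good `z`, a sum over the collision times of
the orbit of `z` in `(s, s + τ]` of a function of the current configuration is the same sum over the
collision times of the orbit of `Φ_s z` in `(0, τ]` (the half-open twin of `finsum_collisionTimes_shift`).
[folklore] -/
theorem finsum_collisionTimes_shift_Ioc {d X : Type*} [Fintype d] [MeasureSpace X] [TopologicalSpace X]
    {G : Geometry d X} {ε : ℝ} {n : ℕ} {A : Type*} [AddCommMonoid A] (Φ : HardSphereFlow G ε n)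
    {z : Config n d X} (hz : z ∈ Φ.good) (s τ : ℝ) (H : Config n d X → A) :
    ∑ᶠ r ∈ collisionTimes G ε (fun t => Φ.flow t z) ∩ Ioc s (s + τ), H (Φ.flow r z) =
      ∑ᶠ r ∈ collisionTimes G ε (fun t => Φ.flow t (Φ.flow s z)) ∩ Ioc 0 τ,
        H (Φ.flow r (Φ.flow s z)) := by
  -- adapted from `finsum_collisionTimes_shift` (`CollisionFluxMeanBoundNonStationary`)
  symm
  refine finsum_mem_eq_of_bijOn (fun r => r + s) ⟨?_, ?_, ?_⟩ fun r _ => by rw [← Φ.flow_add r s z hz]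
  · rintro r ⟨hr, hr0, hrτ⟩
    rw [collisionTimes_flow_shift Φ hz s] at hr
    exact ⟨hr, by linarith, by linarith⟩
  · exact fun r _ r' _ h => by simpa using h
  · rintro u ⟨hu, hus, huτ⟩
    refine ⟨u - s, ⟨?_, by linarith, by linarith⟩, by ring⟩
    rw [collisionTimes_flow_shift Φ hz s, mem_preimage, sub_add_cancel]
    exact hu

/-! ### The registered engine on `𝕋³` -/

/-- **S2 · the pre-collisional one-window flux engine for configuration marks (measurable majorant exported).**
For a hard-sphere flow `Φ` on `𝕋³`, `τ > 0`, a window start `s`, an ARBITRARY configuration mark `F`, measurable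
FORWARD one-window events `E M i j` (containing every non-overlapping `w` whose pair `(i, j)` reaches contact after
a forward free flight of some duration `t ∈ [0, τ/M]`) and measurable majorants `Ft M` of `F` along those flights,
there is a MEASURABLE `g` dominating on the good set the collision sum over `(s, s + τ]` of
`F (collidePair i j (Φ_r z)) i j` over the ordered contact pairs — the mark of the PRE-collisional configuration —
with `∫ g dP ≤ liminf_M Σ_{k<M} ∫ W_M d((Φ_{kτ/M + s})_* P)` for EVERY law `P`,
`W_M = Σ_{i≠j} 𝟙_{E M i j} Ft M (·, i, j)` (pathwise `sum_collision_conf_le_sum_window_fwd` for the orbit of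
`Φ_s z` below the gap of its collision times, Fatou, `lintegral_map`; the forward twin of
`exists_measurable_majorant_collisionSum`, Cercignani–Illner–Pulvirenti 1994 App. 4.A). [folklore] -/
theorem shareRung0_forwardEngine : ∀ {n : ℕ} {ε : ℝ} (Φ : HardSphereFlow (Torus.geometry (Fin 3)) ε n) {τ : ℝ}, 0 < τ → ∀ (s : ℝ) (F : Config n (Fin 3) T3 → Fin n → Fin n → ℝ≥0∞) (E : ℕ → Fin n → Fin n → Set (Config n (Fin 3) T3)), (∀ M i j, MeasurableSet (E M i j)) → (∀ (M : ℕ) (i j : Fin n), i ≠ j → ∀ w ∈ hardSphereDomain (Torus.geometry (Fin 3)) n ε, ∀ t ∈ Set.Icc 0 (τ / M), ‖(Torus.geometry (Fin 3)).sepVec ((freeFlight (Torus.geometry (Fin 3)) t w i).1) ((freeFlight (Torus.geometry (Fin 3)) t w j).1)‖ = ε → w ∈ E M i j) → ∀ (Ft : ℕ → Config n (Fin 3) T3 → Fin n → Fin n → ℝ≥0∞), (∀ M i j, Measurable fun w => Ft M w i j) → (∀ (M : ℕ) (i j : Fin n), i ≠ j → ∀ w ∈ hardSphereDomain (Torus.geometry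 (Fin 3)) n ε, ∀ t ∈ Set.Icc 0 (τ / M), ‖(Torus.geometry (Fin 3)).sepVec ((freeFlight (Torus.geometry (Fin 3)) t w i).1) ((freeFlight (Torus.geometry (Fin 3)) t w j).1)‖ = ε → F (freeFlight (Torus.geometry (Fin 3)) t w) i j ≤ Ft M w i j) → ∃ g : Config n (Fin 3) T3 → ℝ≥0∞, Measurable g ∧ (∀ z ∈ Φ.good, ∑ᶠ r ∈ collisionTimes (Torus.geometry (Fin 3)) ε (fun t => Φ.flow t z) ∩ Set.Ioc s (s + τ), ∑ i : Fin n, ∑ j : Fin n, (if i ≠ j ∧ ‖(Torus.geometry (Fin 3)).sepVec (Φ.flow r z i).1 (Φ.flow r z j).1‖ = ε then F (collidePair (Torus.geometry (Fin 3)) i j (Φ.flow r z)) i j else 0) ≤ g z) ∧ ∀ P : Measure (Config n (Fin 3) T3), ∫⁻ z, g z ∂P ≤ Filter.liminf (fun M : ℕ => ∑ k ∈ Finset.range M, ∫⁻ w, ∑ i : Fin n, ∑ j : Fin n, (if i ≠ j then (E M i j).indicator (fun w => Ft M w i j) w else 0) ∂(P.map (Φ.flow ((k : ℝ) * (τ /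 M) + s)))) Filter.atTop := by
  intro n ε Φ τ hτ s F E hEm hE Ft hFtm hFt
  classical
  -- adapted from `exists_measurable_majorant_collisionSum` (`CollisionFluxMeanBoundNonStationary`):
  -- backward flights ↦ forward flights, grid `Icc 1 M` ↦ `range M`, `F (γ r)` ↦ `F (collidePair i j (γ r))`
  have hG : ∀ x : T3, Continuous ((Torus.geometry (Fin 3)).translate x) := fun x =>
    continuous_const.add Literature.Analysis.FunctionSpaces.Torus.continuous_proj
  set W : ℕ → Config n (Fin 3) T3 → ℝ≥0∞ := fun M w => ∑ i, ∑ j,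
    (if i ≠ j then (E M i j).indicator (fun w => Ft M w i j) w else 0) with hWdef
  have hWm : ∀ M, Measurable (W M) := by
    intro M
    refine Finset.measurable_sum _ fun i _ => Finset.measurable_sum _ fun j _ => ?_
    by_cases hij : i ≠ j
    · simp only [if_pos hij]
      exact (hFtm M i j).indicator (hEm M i j)
    · simp only [if_neg hij]
      exact measurable_const
  set SM : ℕ → Config n (Fin 3) T3 → ℝ≥0∞ := fun M z =>
    ∑ k ∈ Finset.range M, W M (Φ.flow ((k : ℝ) * (τ / M) + s) z) with hSMdef
  have hSMm : ∀ M, Measurable (SM M) := fun M =>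
    Finset.measurable_sum _ fun k _ => (hWm M).comp (Φ.measurable_flow _)
  refine ⟨fun z => liminf (fun M => SM M z) atTop, Measurable.liminf hSMm, fun z hz => ?_, fun P => ?_⟩
  · -- (i) the pathwise bound on the good set, for the orbit of `Φ_s z`
    have hz' : Φ.flow s z ∈ Φ.good := Φ.mapsTo_good s hz
    rw [finsum_collisionTimes_shift_Ioc Φ hz s τ (fun w => ∑ i, ∑ j,
      (if i ≠ j ∧ ‖(Torus.geometry (Fin 3)).sepVec (w i).1 (w j).1‖ = ε then
        F (collidePair (Torus.geometry (Fin 3)) i j w) i j else 0))]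
    have hγ := Φ.isTrajectory _ hz'
    have hfin : (collisionTimes (Torus.geometry (Fin 3)) ε (fun t => Φ.flow t (Φ.flow s z)) ∩
        Ioc 0 τ).Finite :=
      hγ.finite_collisionTimes_inter_of_subset_Icc Ioc_subset_Icc_self
    rw [finsum_mem_eq_finite_toFinset_sum _ hfin]
    obtain ⟨g, hg, hgap⟩ := exists_gap_of_finite (hγ.locFinite 0 τ)
    refine le_liminf_of_le (h := ?_)
    filter_upwards [eventually_gt_atTop ⌈τ / g⌉₊] with M hM
    have hM0 : 0 < M := lt_of_le_of_lt (Nat.zero_le _) hM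
    have hMg : τ / M < g := by
      have h1 : τ / g < M := (Nat.le_ceil _).trans_lt (by exact_mod_cast hM)
      rw [div_lt_iff₀ hg] at h1
      rw [div_lt_iff₀ (by exact_mod_cast hM0)]
      linarith
    have hgap' : ∀ r ∈ collisionTimes (Torus.geometry (Fin 3)) ε (fun t => Φ.flow t (Φ.flow s z)) ∩ Icc 0 τ,
        ∀ r' ∈ collisionTimes (Torus.geometry (Fin 3)) ε (fun t => Φ.flow t (Φ.flow s z)) ∩ Icc 0 τ,
          r < r' → τ / M < r' - r :=
      fun r hr r' hr' hlt => hMg.trans_le (hgap r hr r' hr' hlt)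
    refine (sum_collision_conf_le_sum_window_fwd hγ hG hτ hM0 hgap' hfin (E M) (hE M) F (Ft M)
      (hFt M)).trans (le_of_eq ?_)
    refine Finset.sum_congr rfl fun k _ => ?_
    simp only [hWdef, Φ.flow_add _ s z hz]
  · -- (ii) the mean of each grid sum under the laws at the grid times, (iii) Fatou
    have hmeanM : ∀ M, ∫⁻ z, SM M z ∂P =
        ∑ k ∈ Finset.range M, ∫⁻ w, W M w ∂(P.map (Φ.flow ((k : ℝ) * (τ / M) + s))) := by
      intro M
      calc ∫⁻ z, SM M z ∂P = ∑ k ∈ Finset.range M, ∫⁻ z, W M (Φ.flow ((k : ℝ) * (τ / M) + s) z) ∂P :=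
            lintegral_finsetSum _ fun k _ => (hWm M).comp (Φ.measurable_flow _)
        _ = ∑ k ∈ Finset.range M, ∫⁻ w, W M w ∂(P.map (Φ.flow ((k : ℝ) * (τ / M) + s))) :=
            Finset.sum_congr rfl fun k _ => (lintegral_map (hWm M) (Φ.measurable_flow _)).symm
    calc ∫⁻ z, liminf (fun M => SM M z) atTop ∂P
        ≤ liminf (fun M : ℕ => ∫⁻ z, SM M z ∂P) atTop := lintegral_liminf_le hSMm
      _ = _ := congrArg (fun u : ℕ → ℝ≥0∞ => liminf u atTop) (funext hmeanM)

end QuarticSchurLedger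

end Summit.AtomisticToContinuum.HydrodynamicLimit.Theorems

end
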